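import Summits.NavierStokesRegularity.FunctionalMining.NoGo.TopBotEigHeatCoerciveGtTwo
import Mathlib.Analysis.SpecialFunctions.Sqrt
import Mathlib.Analysis.Convex.Deriv
import Mathlib.Analysis.Calculus.Deriv.Slope
import HarnessLib

/-!
# FunctionalMining / NoGo — K14: the share of a convex splitting of the symmetrised top–bottom density at
# `q = 4` is at most `2/9` (REQUEST #26: the necessity half of the share window)

HONEST FRAMING. Search for candidate a priori estimates; no regularity claim. Nothing about Navier–Stokes is
proved or asserted in this file: a finite-dimensional statement about convex functions on flat `3 × 3`
tensors, proved with one-variable calculus. Cell `pub-nsfunc`, no-go seat (gen 41), kernel candidate K14 (one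
file), answering the LEAD's REQUEST #26 (INBOX l.4584, LOW).

THE TARGET. K9 `NoGo/TopBotEigHeatCoerciveSplit` typed the obligation `TopEig.TopBotEigSplitting q c`: `∃ M ≥ 0`
and a convex `1`-Lipschitz `h` with `h(A) ≥ 0` and `λ(A)^q + λ(−A)^q = M·h(A)^q + c·‖A‖^q` on symmetric
trace-free `A` (`λ = TopEig.lam`, the top Rayleigh value); K10c `NoGo/TopBotEigSplitting` proved it for every
real `q ≥ 2` with the share `shareConst q > 0`. The census / dictionary pens (census-1 (cc.151); dictionary
block 55, `c_axi(4) = 2/9`) put the optimal share at `q = 4` at `c* = 2/9`, on the axisymmetric wall. This file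
proves the NECESSITY in the kernel: **`TopEig.topBotEigSplitting_four_share_le : TopBotEigSplitting 4 c →
c ≤ 2/9`** (every real `c`); the written-out form `share_le_of_convex_splitting_four`;
`not_topBotEigSplitting_four_of_lt (2/9 < c) : ¬ TopBotEigSplitting 4 c`; and, with the tree's K10c, the
two-sided window **`shareConst_four_le : shareConst 4 ≤ 2/9`**, `share_window_four : 0 < shareConst 4 ∧
shareConst 4 ≤ 2/9 ∧ ∀ c, TopBotEigSplitting 4 c → c ≤ 2/9`.

MECHANISM [ours] (no eigenvalue calculus beyond `λ`; the obstruction sits at the exterior axisymmetric wall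
`(2,−1,−1)/3`, not at K10's interior point). §1 The diagonal TEST LINE `A(u) = diag(u, 1 − 2u, u − 1)`
(`lineTens u`): symmetric, trace-free, AFFINE in `u`, with `λ(A(u)) = u` (`u ≥ 1/3`), `λ(−A(u)) = 1 − u`
(`u ≤ 2/3`) — the largest diagonal entry, `lam_le` + `apply_diag_le_lam` — and `‖A(u)‖² = 6u² − 6u + 2`.
§2 Along the line a splitting at `q = 4` reads `N_c(u) := u⁴ + (1 − u)⁴ − c(6u² − 6u + 2)² = M·g(u)⁴` on
`[1/3, 2/3]`, `g = h ∘ A` convex on `ℝ` and `≥ 0`; the polynomials `N_c, N_c′, N_c″`, `T_c = 4N_cN_c″ − 3N_c′²`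
and the WALL VALUES `N_c(2/3) = N_c(1/3) = 17/81 − 4c/9`, `N_c(1/2) = 1/8 − c/4`, **`T_c(2/3) = (64/3)(c − 2/9)
(c − 1/2)`**. §3 WALL LEMMA: for `M > 0` and `2/9 < c < 17/36`, `N_c > 0` and `T_c < 0` on a left
neighbourhood `S = (2/3 − δ, 2/3)` of the wall (continuity); on `S`, `g = √√(N_c/M)` is differentiable with an
explicit derivative `φ`; convexity makes `deriv g = φ` monotone on `S` (`ConvexOn.monotoneOn_deriv`), so
`0 ≤ deriv φ` at the interior point `2/3 − δ/2` (`MonotoneOn.derivWithin_nonneg`); but `deriv φ =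
(4PP″ − 3P′²)/(16 P^{7/4})`, `P = N_c/M`, has the sign of `T_c < 0`. §4 Residual shares: `M·g(2/3)⁴ = N_c(2/3)
≥ 0` forces `c ≤ 17/36`; `M = 0` forces `N_c(1/2) = N_c(2/3) = 0`, i.e. `c = 1/2 = 17/36`; `c = 17/36` with
`M > 0` forces `g(1/3) = g(2/3) = 0`, so `g(1/2) = 0` by convexity and `N_c(1/2) = 0`, i.e. `c = 1/2` — absurd.

NOT CLAIMED. Sufficiency AT `c = 2/9` (a splitting with share exactly `2/9`) is the census-1 pen / 1-D kernel
composition route of (cc.151), not this file; the tree's proved share stays K10c's `shareConst 4 = 1/999` (K10d).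
Nothing for `q ≠ 4` (the same line gives at the wall the necessary `q·N·N″ − (q−1)·N′² ≥ 0` for
`N = u^q + (1−u)^q − c(6u²−6u+2)^{q/2}` at `u = 2/3`, i.e. `c ≤ c_axi(q)` of dictionary block 55 — not typed).
No Navier–Stokes statement, no `𝒦₀` row, no count, no numerics. References: tree `TopEigRayleigh` (`lam`,
`lam_le`, `apply_diag_le_lam`, `quad_smul`), K9 (`TopBotEigSplitting`), K10b (`shareConst`, `shareConst_pos`),
K10c (`topBotEigSplitting_shareConst`), all through K10d `NoGo/TopBotEigHeatCoerciveGtTwo`; Mathlib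
`ConvexOn.monotoneOn_deriv`, `MonotoneOn.derivWithin_nonneg`, `HasDerivAt.sqrt`, `derivWithin_of_isOpen`.
FILING (prove seat g26, REQUEST #29): declarations byte-identical to the no-go seat's staged `TopBotEigSplitShareNecessity.STAGING.lean` f58eab3cf9b3ef05; this line is the only addition.
-/

open Set Filter Topology

noncomputable section

namespace Summit.NavierStokesRegularity.FunctionalMining

namespace TopEig

/-! ## 1. The diagonal test line `A(u) = diag(u, 1 − 2u, u − 1)` -/

/-- Diagonal entries `(u, 1 − 2u, u − 1)` of the test line. [ours; bookkeeping] -/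
def lineDiag (u : ℝ) : Fin 3 → ℝ := ![u, 1 - 2 * u, u - 1]

/-- The diagonal test tensor `A(u) = diag(u, 1 − 2u, u − 1)`. [ours; bookkeeping] -/
def lineTens (u : ℝ) : EuclideanSpace ℝ (Fin 3 × Fin 3) :=
  WithLp.toLp 2 fun ij : Fin 3 × Fin 3 => if ij.1 = ij.2 then lineDiag u ij.1 else 0

/-- Entries of `A(u)`. [bookkeeping] -/
@[simp] theorem lineTens_apply (u : ℝ) (i j : Fin 3) :
    lineTens u (i, j) = if i = j then lineDiag u i else 0 := rfl

/-- The diagonal entries `A(u)₀₀ = u`, `A(u)₁₁ = 1 − 2u`, `A(u)₂₂ = u − 1`. [bookkeeping] -/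
@[simp] theorem lineDiag_val (u : ℝ) :
    lineDiag u 0 = u ∧ lineDiag u 1 = 1 - 2 * u ∧ lineDiag u 2 = u - 1 := ⟨rfl, rfl, rfl⟩

/-- `A(u)` is symmetric. [bookkeeping] -/
theorem lineTens_symm (u : ℝ) (i j : Fin 3) : lineTens u (i, j) = lineTens u (j, i) := by
  simp only [lineTens_apply]
  by_cases h : i = j
  · subst h; rfl
  · rw [if_neg h, if_neg (Ne.symm h)]

/-- `A(u)` is trace-free. [bookkeeping] -/
theorem lineTens_trace (u : ℝ) : ∑ i, lineTens u (i, i) = 0 := by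
  simp only [Fin.sum_univ_three, lineTens_apply, if_true, lineDiag_val]
  ring

/-- The Rayleigh form of `A(u)`: `eᵀA(u)e = u e₀² + (1 − 2u) e₁² + (u − 1) e₂²`. [bookkeeping] -/
theorem quad_lineTens (u : ℝ) (e : Fin 3 → ℝ) :
    quad (lineTens u) e = u * e 0 ^ 2 + (1 - 2 * u) * e 1 ^ 2 + (u - 1) * e 2 ^ 2 := by
  simp [quad, Fin.sum_univ_three]
  ring

/-- `A(u)` is affine in `u`: `A(a x + b y) = a A(x) + b A(y)` for `a + b = 1`. [bookkeeping] -/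
theorem lineTens_affine {a b : ℝ} (hab : a + b = 1) (x y : ℝ) :
    lineTens (a * x + b * y) = a • lineTens x + b • lineTens y := by
  ext ⟨i, j⟩
  simp only [lineTens_apply, PiLp.add_apply, PiLp.smul_apply, smul_eq_mul]
  by_cases h : i = j
  · subst h
    simp only [if_true]
    fin_cases i
    · simp
    · simp; linear_combination -hab
    · simp; linear_combination hab
  · simp [h]

/-- **`λ(A(u)) = u` for `u ≥ 1/3`** (`u` is then the largest diagonal entry). [ours; bookkeeping] -/
theorem lam_lineTens {u : ℝ} (hu : 1 / 3 ≤ u) : lam (lineTens u) = u := by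
  apply le_antisymm
  · refine lam_le fun e he => ?_
    rw [quad_lineTens]
    have h1 : e 0 * e 0 + e 1 * e 1 + e 2 * e 2 = 1 := by
      simpa [dotProduct, Fin.sum_univ_three] using he
    nlinarith [mul_nonneg (by linarith : (0 : ℝ) ≤ 3 * u - 1) (mul_self_nonneg (e 1)),
      mul_self_nonneg (e 2)]
  · simpa using apply_diag_le_lam (lineTens u) 0

/-- **`λ(−A(u)) = 1 − u` for `u ≤ 2/3`** (`1 − u` is the largest entry of `−A(u)`). [ours; bookkeeping] -/
theorem lam_neg_lineTens {u : ℝ} (hu : u ≤ 2 / 3) : lam (-lineTens u) = 1 - u := by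
  apply le_antisymm
  · refine lam_le fun e he => ?_
    have hq : quad (-lineTens u) e = -quad (lineTens u) e := by
      rw [← neg_one_smul ℝ (lineTens u), quad_smul]; ring
    rw [hq, quad_lineTens]
    have h1 : e 0 * e 0 + e 1 * e 1 + e 2 * e 2 = 1 := by
      simpa [dotProduct, Fin.sum_univ_three] using he
    nlinarith [mul_nonneg (by linarith : (0 : ℝ) ≤ 2 - 3 * u) (mul_self_nonneg (e 1)),
      mul_self_nonneg (e 0)]
  · have h := apply_diag_le_lam (-lineTens u) 2
    have h2 : (-lineTens u) (2, 2) = 1 - u := by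
      simp only [WithLp.ofLp_neg, Pi.neg_apply, lineTens_apply, if_true, lineDiag_val]; ring
    linarith

/-- `‖A(u)‖² = u² + (1 − 2u)² + (u − 1)² = 6u² − 6u + 2`. [bookkeeping] -/
theorem norm_sq_lineTens (u : ℝ) : ‖lineTens u‖ ^ 2 = 6 * u ^ 2 - 6 * u + 2 := by
  rw [EuclideanSpace.norm_sq_eq, Fintype.sum_prod_type]
  simp [Fin.sum_univ_three, Real.norm_eq_abs, sq_abs]
  ring

/-! ## 2. The one-variable polynomials of the line at `q = 4` -/

/-- `N_c(u) = u⁴ + (1 − u)⁴ − c (6u² − 6u + 2)²` (= `λ⁴ + λ(−·)⁴ − c‖·‖⁴` along the line on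
`[1/3, 2/3]`). [ours] -/
def N (c u : ℝ) : ℝ := u ^ 4 + (1 - u) ^ 4 - c * (6 * u ^ 2 - 6 * u + 2) ^ 2

/-- `N_c′`. [ours] -/
def N1 (c u : ℝ) : ℝ := 4 * u ^ 3 - 4 * (1 - u) ^ 3 - 2 * c * (6 * u ^ 2 - 6 * u + 2) * (12 * u - 6)

/-- `N_c″`. [ours] -/
def N2 (c u : ℝ) : ℝ :=
  12 * u ^ 2 + 12 * (1 - u) ^ 2 - 2 * c * ((12 * u - 6) ^ 2 + (6 * u ^ 2 - 6 * u + 2) * 12)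

/-- `T_c = 4 N_c N_c″ − 3 N_c′²` (the numerator of `(N_c^{1/4})″`). [ours] -/
def T (c u : ℝ) : ℝ := 4 * N c u * N2 c u - 3 * N1 c u ^ 2

/-- `N_c′ ` is the derivative of `N_c`. [bookkeeping] -/
theorem hasDerivAt_N (c u : ℝ) : HasDerivAt (N c) (N1 c u) u := by
  have h : HasDerivAt (fun x : ℝ => x ^ 4 + (1 - x) ^ 4 - c * (6 * x ^ 2 - 6 * x + 2) ^ 2) _ u :=
    (((hasDerivAt_id' u).pow 4).add (((hasDerivAt_id' u).const_sub 1).pow 4)).sub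
      (((((((hasDerivAt_id' u).pow 2).const_mul 6).sub ((hasDerivAt_id' u).const_mul 6)).add_const
        2).pow 2).const_mul c)
  show HasDerivAt (fun x : ℝ => x ^ 4 + (1 - x) ^ 4 - c * (6 * x ^ 2 - 6 * x + 2) ^ 2) (N1 c u) u
  convert h using 1
  simp only [N1, Pi.sub_apply, Pi.pow_apply]
  push_cast
  ring

/-- `N_c″` is the derivative of `N_c′`. [bookkeeping] -/
theorem hasDerivAt_N1 (c u : ℝ) : HasDerivAt (N1 c) (N2 c u) u := by
  have h : HasDerivAt (fun x : ℝ => 4 * x ^ 3 - 4 * (1 - x) ^ 3 -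
      2 * c * (6 * x ^ 2 - 6 * x + 2) * (12 * x - 6)) _ u :=
    ((((hasDerivAt_id' u).pow 3).const_mul 4).sub ((((hasDerivAt_id' u).const_sub 1).pow
      3).const_mul 4)).sub
      (((((((hasDerivAt_id' u).pow 2).const_mul 6).sub ((hasDerivAt_id' u).const_mul 6)).add_const
        2).const_mul (2 * c)).mul (((hasDerivAt_id' u).const_mul 12).sub_const 6))
  show HasDerivAt (fun x : ℝ => 4 * x ^ 3 - 4 * (1 - x) ^ 3 -
      2 * c * (6 * x ^ 2 - 6 * x + 2) * (12 * x - 6)) (N2 c u) u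
  convert h using 1
  simp only [N2, Pi.sub_apply, Pi.pow_apply]
  push_cast
  ring

/-- The values `N_c(2/3) = N_c(1/3) = 17/81 − 4c/9`, `N_c(1/2) = 1/8 − c/4`. [bookkeeping] -/
theorem N_values (c : ℝ) : N c (2 / 3) = 17 / 81 - 4 * c / 9 ∧ N c (1 / 3) = 17 / 81 - 4 * c / 9 ∧
    N c (1 / 2) = 1 / 8 - c / 4 := by
  refine ⟨?_, ?_, ?_⟩ <;> simp only [N] <;> ring

/-- **The wall value** `T_c(2/3) = (64/3)(c − 2/9)(c − 1/2)`. [ours] -/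
theorem T_two_thirds (c : ℝ) : T c (2 / 3) = 64 / 3 * (c - 2 / 9) * (c - 1 / 2) := by
  simp only [T, N, N1, N2]; ring

/-- Near the wall `u = 2/3`: `N_c > 0` and `T_c < 0` whenever this holds at `2/3`. [bookkeeping] -/
theorem exists_nhds_wall {c : ℝ} (hN : 0 < N c (2 / 3)) (hT : T c (2 / 3) < 0) :
    ∃ δ : ℝ, 0 < δ ∧ δ ≤ 1 / 3 ∧ ∀ u : ℝ, |u - 2 / 3| < δ → 0 < N c u ∧ T c u < 0 := by
  have cN : Continuous (N c) := by unfold N; fun_prop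
  have cT : Continuous (T c) := by unfold T N N1 N2; fun_prop
  obtain ⟨δ₁, hδ₁, h₁⟩ := Metric.continuousAt_iff.mp (cN.continuousAt (x := 2 / 3)) (N c (2 / 3)) hN
  obtain ⟨δ₂, hδ₂, h₂⟩ :=
    Metric.continuousAt_iff.mp (cT.continuousAt (x := 2 / 3)) (-T c (2 / 3)) (by linarith)
  refine ⟨min (min δ₁ δ₂) (1 / 3), by positivity, min_le_right _ _, fun u hu => ?_⟩
  have hu1 : dist u (2 / 3) < δ₁ := by
    rw [Real.dist_eq]; exact hu.trans_le ((min_le_left _ _).trans (min_le_left _ _))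
  have hu2 : dist u (2 / 3) < δ₂ := by
    rw [Real.dist_eq]; exact hu.trans_le ((min_le_left _ _).trans (min_le_right _ _))
  have e1 := h₁ hu1; have e2 := h₂ hu2; rw [Real.dist_eq] at e1 e2
  exact ⟨by linarith [abs_lt.mp e1], by linarith [abs_lt.mp e2]⟩

/-! ## 3. The wall lemma: no convex fourth root -/

/-- **Wall lemma.** If `M > 0`, `2/9 < c < 17/36`, `g` is convex on `ℝ`, `g ≥ 0`, and
`M g(u)⁴ = N_c(u)` on `[1/3, 2/3]`, contradiction: `g = (N_c/M)^{1/4}` is `C²` to the left of the wall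
`u = 2/3` with `g″ = T_c/(16 M² g⁷)` and `T_c(2/3) < 0`. [ours] -/
theorem wall_lemma {c M : ℝ} (hM : 0 < M) (hc1 : 2 / 9 < c) (hc2 : c < 17 / 36) {g : ℝ → ℝ}
    (hg : ConvexOn ℝ univ g) (hg0 : ∀ u, 0 ≤ g u)
    (hid : ∀ u : ℝ, 1 / 3 ≤ u → u ≤ 2 / 3 → M * g u ^ 4 = N c u) : False := by
  have hN : 0 < N c (2 / 3) := by rw [(N_values c).1]; linarith
  have hT : T c (2 / 3) < 0 := by rw [T_two_thirds]; nlinarith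
  obtain ⟨δ, hδ, hδ3, hnb⟩ := exists_nhds_wall hN hT
  -- the open interval to the left of the wall
  set S : Set ℝ := Ioo (2 / 3 - δ) (2 / 3) with hS
  have hSwall : ∀ u ∈ S, |u - 2 / 3| < δ := fun u hu => by
    rw [abs_lt]; constructor <;> linarith [hu.1, hu.2]
  have hSI : ∀ u ∈ S, 1 / 3 ≤ u ∧ u ≤ 2 / 3 := fun u hu => ⟨by linarith [hu.1], hu.2.le⟩
  -- `P = N/M`, `G = √√P`
  set P : ℝ → ℝ := fun u => N c u / M with hP
  have hPpos : ∀ u ∈ S, 0 < P u := fun u hu => div_pos (hnb u (hSwall u hu)).1 hM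
  have hPd : ∀ u, HasDerivAt P (N1 c u / M) u := fun u => (hasDerivAt_N c u).div_const M
  set G : ℝ → ℝ := fun u => Real.sqrt (Real.sqrt (P u)) with hG
  have hgG : ∀ u ∈ S, g u = G u := by
    intro u hu
    have h4 : g u ^ 4 = P u := by
      simp only [hP]; rw [← hid u (hSI u hu).1 (hSI u hu).2]; field_simp
    have h2 : Real.sqrt (P u) = g u ^ 2 := by
      rw [← h4, show g u ^ 4 = (g u ^ 2) ^ 2 by ring, Real.sqrt_sq (sq_nonneg _)]
    simp only [hG]; rw [h2, Real.sqrt_sq (hg0 u)]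
  -- the explicit derivative of `G`
  set φ : ℝ → ℝ := fun u =>
    ((N1 c u / M) / (2 * Real.sqrt (P u))) / (2 * Real.sqrt (Real.sqrt (P u))) with hφ
  have hGd : ∀ u ∈ S, HasDerivAt G (φ u) u := by
    intro u hu
    have hne : P u ≠ 0 := (hPpos u hu).ne'
    have hne2 : Real.sqrt (P u) ≠ 0 := Real.sqrt_ne_zero'.mpr (hPpos u hu)
    exact ((hPd u).sqrt hne).sqrt hne2
  have hgd : ∀ u ∈ S, HasDerivAt g (φ u) u := by
    intro u hu
    refine (hGd u hu).congr_of_eventuallyEq ?_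
    filter_upwards [Ioo_mem_nhds hu.1 hu.2] with y hy
    exact hgG y hy
  -- monotone derivative on `S`
  have hmono : MonotoneOn (deriv g) S :=
    (hg.subset (subset_univ S) (convex_Ioo _ _)).monotoneOn_deriv
      fun u hu => (hgd u hu).differentiableAt
  have hmonoφ : MonotoneOn φ S := hmono.congr fun u hu => (hgd u hu).deriv
  -- the test point
  set x : ℝ := 2 / 3 - δ / 2 with hx
  have hxS : x ∈ S := ⟨by simp only [hx]; linarith, by simp only [hx]; linarith⟩
  have hPx : 0 < P x := hPpos x hxS
  have hTx : T c x < 0 := (hnb x (hSwall x hxS)).2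
  -- abbreviations at the test point
  set a : ℝ := N1 c x / M with ha
  set b : ℝ := N2 c x / M with hb
  set r : ℝ := Real.sqrt (P x) with hr
  set w : ℝ := Real.sqrt r with hw
  have hr0 : 0 < r := Real.sqrt_pos.mpr hPx
  have hw0 : 0 < w := Real.sqrt_pos.mpr hr0
  -- derivative of `φ` at `x`
  have hd1 : HasDerivAt (fun u => N1 c u / M) b x := (hasDerivAt_N1 c x).div_const M
  have hd2 : HasDerivAt (fun u => 2 * Real.sqrt (P u)) (2 * (a / (2 * r))) x :=
    ((hPd x).sqrt hPx.ne').const_mul 2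
  have hd3 : HasDerivAt (fun u => N1 c u / M / (2 * Real.sqrt (P u)))
      ((b * (2 * r) - a * (2 * (a / (2 * r)))) / (2 * r) ^ 2) x :=
    hd1.div hd2 (mul_ne_zero two_ne_zero hr0.ne')
  have hd4 : HasDerivAt (fun u => 2 * Real.sqrt (Real.sqrt (P u)))
      (2 * (a / (2 * r) / (2 * w))) x :=
    (((hPd x).sqrt hPx.ne').sqrt hr0.ne').const_mul 2
  have hd5 : HasDerivAt φ
      (((b * (2 * r) - a * (2 * (a / (2 * r)))) / (2 * r) ^ 2 * (2 * w) -
        a / (2 * r) * (2 * (a / (2 * r) / (2 * w)))) / (2 * w) ^ 2) x :=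
    hd3.div hd4 (mul_ne_zero two_ne_zero hw0.ne')
  -- monotone `φ` has a non-negative derivative at the interior point `x`
  have hderiv_nonneg : 0 ≤ derivWithin φ S x := hmonoφ.derivWithin_nonneg
  rw [derivWithin_of_isOpen isOpen_Ioo hxS, hd5.deriv] at hderiv_nonneg
  -- algebra: everything in terms of `w = P(x)^{1/4}`
  have hrw : r = w ^ 2 := (Real.sq_sqrt hr0.le).symm
  have hpw : P x = w ^ 4 := by
    rw [show w ^ 4 = (w ^ 2) ^ 2 by ring, ← hrw, hr, Real.sq_sqrt hPx.le]
  have hkey : 4 * P x * b - 3 * a ^ 2 < 0 := by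
    have h1 : 4 * P x * b - 3 * a ^ 2 = T c x / M ^ 2 := by
      simp only [ha, hb, hP, T]
      field_simp
    rw [h1]
    exact div_neg_of_neg_of_pos hTx (by positivity)
  rw [hpw] at hkey
  rw [hrw] at hderiv_nonneg
  have hval : ((b * (2 * w ^ 2) - a * (2 * (a / (2 * w ^ 2)))) / (2 * w ^ 2) ^ 2 * (2 * w) -
      a / (2 * w ^ 2) * (2 * (a / (2 * w ^ 2) / (2 * w)))) / (2 * w) ^ 2 =
      (4 * w ^ 4 * b - 3 * a ^ 2) / (16 * w ^ 7) := by
    field_simp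
    ring
  rw [hval] at hderiv_nonneg
  exact absurd hderiv_nonneg (not_le.mpr (div_neg_of_neg_of_pos hkey (by positivity)))

/-! ## 4. The necessity of the share `c ≤ 2/9` at `q = 4` -/

/-- **Sharp-share necessity at `q = 4`.** Every convex `1`-Lipschitz non-negative splitting
`λ(A)⁴ + λ(−A)⁴ = M h(A)⁴ + c‖A‖⁴` of the symmetrised top–bottom density on symmetric trace-free
`3 × 3` tensors has share `c ≤ 2/9`. Search for candidate a priori estimates; no regularity claim.
[ours; REQUEST #26, the necessity half of the share window at `q = 4`] -/
theorem topBotEigSplitting_four_share_le {c : ℝ} (hs : TopBotEigSplitting 4 c) : c ≤ 2 / 9 := by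
  obtain ⟨M, hM, h, hconv, -, hall⟩ := hs
  set g : ℝ → ℝ := fun u => h (lineTens u) with hg
  have hg0 : ∀ u, 0 ≤ g u := fun u => (hall _ (lineTens_symm u) (lineTens_trace u)).1
  have hid : ∀ u : ℝ, 1 / 3 ≤ u → u ≤ 2 / 3 → M * g u ^ 4 = N c u := by
    intro u hu1 hu2
    have h2 := (hall _ (lineTens_symm u) (lineTens_trace u)).2
    rw [lam_lineTens hu1, lam_neg_lineTens hu2] at h2
    simp only [Real.rpow_ofNat] at h2
    have hn : ‖lineTens u‖ ^ 4 = (6 * u ^ 2 - 6 * u + 2) ^ 2 := by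
      rw [← norm_sq_lineTens]; ring
    rw [hn] at h2
    simp only [hg, N]
    linarith
  have hgc : ConvexOn ℝ univ g := by
    refine ⟨convex_univ, fun x _ y _ a b ha hb hab => ?_⟩
    simp only [hg, smul_eq_mul]
    rw [lineTens_affine hab]
    exact hconv.2 (mem_univ _) (mem_univ _) ha hb hab
  by_contra hc
  rw [not_le] at hc
  have e23 := hid (2 / 3) (by norm_num) le_rfl
  have e13 := hid (1 / 3) le_rfl (by norm_num)
  have e12 := hid (1 / 2) (by norm_num) (by norm_num)
  rw [(N_values c).1] at e23
  rw [(N_values c).2.1] at e13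
  rw [(N_values c).2.2] at e12
  rcases hM.eq_or_lt with hM0 | hMpos
  · -- `M = 0`: `N_c ≡ 0` at `u = 1/2` and `u = 2/3` is impossible
    rw [← hM0] at e23 e12
    simp only [zero_mul] at e23 e12
    linarith
  rcases lt_or_ge c (17 / 36) with hlt | hge
  · exact wall_lemma hMpos hc hlt hgc hg0 hid
  · -- `c ≥ 17/36`: `g(1/3) = g(2/3) = 0`, convexity gives `g(1/2) = 0`, i.e. `c = 1/2`
    have h4 : ∀ u, 0 ≤ M * g u ^ 4 := fun u => by positivity
    have hc' : c = 17 / 36 := by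
      have := h4 (2 / 3); rw [e23] at this; linarith
    have hz : ∀ u, M * g u ^ 4 = 0 → g u = 0 := fun u hu => by
      rcases mul_eq_zero.mp hu with h0 | h0
      · exact absurd h0 hMpos.ne'
      · exact pow_eq_zero_iff (by norm_num) |>.mp h0
    have g23 : g (2 / 3) = 0 := hz _ (by rw [e23, hc']; norm_num)
    have g13 : g (1 / 3) = 0 := hz _ (by rw [e13, hc']; norm_num)
    have hmid := hgc.2 (mem_univ (1 / 3 : ℝ)) (mem_univ (2 / 3 : ℝ)) (by norm_num : (0 : ℝ) ≤ 1 / 2)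
      (by norm_num : (0 : ℝ) ≤ 1 / 2) (by norm_num)
    simp only [smul_eq_mul, g13, g23, mul_zero, add_zero] at hmid
    rw [show (1 / 2 : ℝ) * (1 / 3) + 1 / 2 * (2 / 3) = 1 / 2 by norm_num] at hmid
    have g12 : g (1 / 2) = 0 := le_antisymm hmid (hg0 _)
    rw [g12] at e12; simp at e12; linarith

/-- The same statement with the obligation written out (no tree constant but `TopEig.lam`).
[ours; bookkeeping] -/
theorem share_le_of_convex_splitting_four {c M : ℝ} (hM : 0 ≤ M)
    {h : EuclideanSpace ℝ (Fin 3 × Fin 3) → ℝ} (hconv : ConvexOn ℝ univ h) (hlip : LipschitzWith 1 h)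
    (hall : ∀ A : EuclideanSpace ℝ (Fin 3 × Fin 3), (∀ i j, A (i, j) = A (j, i)) →
      ∑ i, A (i, i) = 0 → 0 ≤ h A ∧ lam A ^ (4 : ℝ) + lam (-A) ^ (4 : ℝ) =
        M * h A ^ (4 : ℝ) + c * ‖A‖ ^ (4 : ℝ)) : c ≤ 2 / 9 :=
  topBotEigSplitting_four_share_le ⟨M, hM, h, hconv, hlip, hall⟩

/-- **No splitting at `q = 4` with a share above `2/9`.** [ours] -/
theorem not_topBotEigSplitting_four_of_lt {c : ℝ} (hc : 2 / 9 < c) : ¬ TopBotEigSplitting 4 c :=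
  fun hs => absurd (topBotEigSplitting_four_share_le hs) (not_le.mpr hc)

/-- **The share window at `q = 4` is two-sided in the kernel**: K10c's share satisfies
`shareConst 4 ≤ 2/9`. [ours; K10c `topBotEigSplitting_shareConst` + the necessity] -/
theorem shareConst_four_le : shareConst 4 ≤ 2 / 9 :=
  topBotEigSplitting_four_share_le (topBotEigSplitting_shareConst (by norm_num))

/-- **Share window at `q = 4`**: `0 < shareConst 4 ≤ 2/9` and every splitting share is `≤ 2/9`.
Search for candidate a priori estimates; no regularity claim. [ours; summary] -/
theorem share_window_four :
    0 < shareConst 4 ∧ shareConst 4 ≤ 2 / 9 ∧ ∀ c : ℝ, TopBotEigSplitting 4 c → c ≤ 2 / 9 :=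
  ⟨shareConst_pos (by norm_num), shareConst_four_le, fun _ hs => topBotEigSplitting_four_share_le hs⟩

end TopEig

end Summit.NavierStokesRegularity.FunctionalMining

end
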